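import Literature.Combinatorics.Optimization.LovaszSchrijverMatchingRank
import HarnessLib

/-!
# Stephen–Tunçel 1999, Lemma 4.2 — PROVED (`StephenTuncel1999_lemma42_holds`)

T. Stephen, L. Tunçel, *On a representation of the matching polytope via semidefinite liftings*,
Math. Oper. Res. **24** (1999) 1–7 [StephenTuncel1999] (held: `paper:doi-10-1287-moor-24-1-1`),
§4 (pp. 3–6). This file discharges the named fact
`Literature.Combinatorics.Optimization.StephenTuncel1999.StephenTuncel1999_lemma42` of
`LovaszSchrijverMatchingRank.lean`:

> **Lemma 4.2.** `(1, (1/2n) e) ∈ N^{n-1}₊(P(2n+1))`, for all `n ≥ 1`.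

so that the lower-bound half of Theorem 5.1 — "at least `n` iterations of the [Lovász–Schrijver
`N₊`] procedure are needed" for the matching polytope of `K_{2n+1}` — is an unconditional tree
theorem (`iterate_Nplus_ne_matchingCone`); Theorem 5.1 in full now rests on the upper bound
`StephenTuncel1999_rank_le_half` alone (`StephenTuncel1999_thm51_of_rank_le_half`).

## The printed proof and how it is followed

* **Lemma 4.1** (pp. 3–4): for an edge `i` of the `(2k+3)`-clique, the map `ζ ↦ wⁱ(ζ)` (copy the
  `(2k+1)`-clique on the complement of `i`, put `ζ₀` on coordinates `0` and `i`, and `0` on the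
  edges meeting `i`) sends `Nʳ₊(P(2k+1))` into `Nʳ₊(P(2k+3))`, by induction on `r` with the block
  matrix `Ỹ` ("every principal submatrix of `Ỹ` either has zero determinant or is equal to a
  principal submatrix of `Y`"). Part I below proves this for an ABSTRACT coordinate pattern
  (`LovaszSchrijver.transferVec`, `transferMat = E Y Eᵀ`, `transfer_Nplus`,
  `transfer_iterate_Nplus`); Part II instantiates the pattern `srcOf i` on the subtype
  `W_i = {v // v ∉ i}` and proves the base case `wⁱ(P(K_{W_i})) ⊆ P(K_V)`
  (`transferVec_srcOf_mem`). We use the homogeneous form `wⁱ(ζ)_i = ζ₀` of the printed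
  "`1` if `j = 0` or `j = i`" (the source assumes `ζ₀ = 1`), which makes `wⁱ` linear.
* **Lemma 4.2** (pp. 4–6): induction on `n`; the matrix `Y` with `Yeᵢ = wⁱ(ζ)/(2k+2)`,
  `Ye₀ = (1, e/(2k+2)) = (2/(2k+3)) Σᵢ Yeᵢ`, the identity expressing `Y(e₀ − eᵢ)` as
  `(1/(2(2k+2)))·Σ_{l adjacent to i} wˡ(ζ)`, and positive semidefiniteness of
  `Ŷ = 2k(2k+2) Y` via its spectrum `{6k²+7k, 2k+1, 0}`. Part III follows this with ONE
  deviation in technique (not in content): instead of eigenvectors ("signed incidence vectors of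
  even cycles", "complete bipartite" vectors) we use the incidence matrix `B` of `K_{2k+3}` and
  the identities `B Bᵀ = (N−2)I + J`, `S² = (N−2)S + 4J`, `JS = SJ = 2(N−1)J` for `S = BᵀB`
  (`S_{ef} = |e ∩ f|`), which give (a) the two nonnegative-combination identities as the matrix
  identities `S Û = 4k J`, `J Û = k(2k+3) J` for the edge block `Û = (2k+1)I + J − S` of `Ŷ`,
  and (b) the explicit PSD decomposition `Y = c cᵀ/(2k(2k+2))² + (0 ⊕ R')/(2k(2k+2)(k+1))`
  with `R' = (2k+1)(k+1)I + J − (k+1)S`, `R'² = (2k+1)(k+1)R'` (so `R' ⪰ 0`; `R'` is a multiple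
  of the projection onto `ker B`, the `2k+1`-eigenspace of the source). Part IV runs the
  induction over all finite vertex types of odd size (`zetaOf_mem_iterate_Nplus`) and specialises
  to `Fin (2n+1)`.

No new definitions of mathematical notions beyond proof plumbing (patterns, incidence matrices,
the explicit matrices of the proof); no named facts; axioms standard.
-/

noncomputable section

open Matrix Finset


namespace Literature.Combinatorics.Optimization

namespace LovaszSchrijver

/-! ## Part I. Lemma 4.1's engine: `N₊` commutes with coordinate-pattern maps

A *pattern* `src : Option ι' → Option (Option ι)` prescribes, for each target coordinate `p`,
either a source coordinate `s` to copy (`src p = some s`) or the zero row (`src p = none`).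
The induced linear map `T` (`transferVec`) and the congruence `Y ↦ E Y Eᵀ` (`transferMat`) are
the maps `ζ ↦ wⁱ(ζ)` and `Y ↦ Ỹ` of the proof of Lemma 4.1 (p. 4). -/

variable {ι ι' : Type*}

/-- The linear map `T` of a pattern: `(T x)_p = x_{src p}` or `0`.
[cite: StephenTuncel1999, §4, definition of `wⁱ` (p. 3)] -/
def transferVec (src : Option ι' → Option (Option ι)) (x : Option ι → ℝ) : Option ι' → ℝ :=
  fun p => (src p).elim 0 x

/-- The congruence `Ỹ` of a pattern: `Ỹ_{pq} = Y_{src p, src q}` or `0`.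
[cite: StephenTuncel1999, proof of Lemma 4.1, the matrix `Ỹ` (p. 4)] -/
def transferMat (src : Option ι' → Option (Option ι)) (Y : Matrix (Option ι) (Option ι) ℝ) :
    Matrix (Option ι') (Option ι') ℝ :=
  fun p q => (src p).elim 0 fun s => (src q).elim 0 fun t => Y s t

/-- The 0-1 matrix `E` of a pattern (`Ỹ = E Y Eᵀ`). [cite: StephenTuncel1999, proof of Lemma 4.1 (p. 4)] -/
def transferE [DecidableEq ι] (src : Option ι' → Option (Option ι)) :
    Matrix (Option ι') (Option ι) ℝ :=
  fun p s => if src p = some s then 1 else 0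

/-- `T` is additive. [cite: StephenTuncel1999, §4 (p. 3)] -/
theorem transferVec_add (src : Option ι' → Option (Option ι)) (x y : Option ι → ℝ) :
    transferVec src (x + y) = transferVec src x + transferVec src y := by
  ext p; simp only [transferVec, Pi.add_apply]; cases src p <;> simp

/-- `T` commutes with subtraction. [cite: StephenTuncel1999, §4 (p. 3)] -/
theorem transferVec_sub (src : Option ι' → Option (Option ι)) (x y : Option ι → ℝ) :
    transferVec src (x - y) = transferVec src x - transferVec src y := by
  ext p; simp only [transferVec, Pi.sub_apply]; cases src p <;> simp

/-- `T` is homogeneous. [cite: StephenTuncel1999, §4 (p. 3)] -/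
theorem transferVec_smul (src : Option ι' → Option (Option ι)) (c : ℝ) (x : Option ι → ℝ) :
    transferVec src (c • x) = c • transferVec src x := by
  ext p; simp only [transferVec, Pi.smul_apply]; cases src p <;> simp

/-- `T 0 = 0`. [cite: StephenTuncel1999, §4 (p. 3)] -/
theorem transferVec_zero (src : Option ι' → Option (Option ι)) :
    transferVec src (0 : Option ι → ℝ) = 0 := by
  ext p; simp only [transferVec, Pi.zero_apply]; cases src p <;> simp

/-- `T` of a finite sum. [cite: StephenTuncel1999, §4 (p. 3)] -/
theorem transferVec_sum {α : Type*} (src : Option ι' → Option (Option ι)) (s : Finset α)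
    (f : α → Option ι → ℝ) :
    transferVec src (∑ a ∈ s, f a) = ∑ a ∈ s, transferVec src (f a) := by
  classical
  induction s using Finset.induction_on with
  | empty => simp [transferVec_zero]
  | insert a s ha ih => rw [sum_insert ha, sum_insert ha, transferVec_add, ih]

/-- Coordinates of `T x`: a copied coordinate. [cite: StephenTuncel1999, §4 (p. 3)] -/
theorem transferVec_apply_of_eq_some {src : Option ι' → Option (Option ι)} {p : Option ι'}
    {s : Option ι} (h : src p = some s) (x : Option ι → ℝ) : transferVec src x p = x s := by
  simp [transferVec, h]

/-- Coordinates of `T x`: a zero coordinate. [cite: StephenTuncel1999, §4 (p. 3)] -/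
theorem transferVec_apply_of_eq_none {src : Option ι' → Option (Option ι)} {p : Option ι'}
    (h : src p = none) (x : Option ι → ℝ) : transferVec src x p = 0 := by
  simp [transferVec, h]

/-- Rows of `Ỹ`: `T` of the corresponding row of `Y`, or zero. [cite: StephenTuncel1999, proof of Lemma 4.1 (p. 4)] -/
theorem transferMat_row (src : Option ι' → Option (Option ι)) (Y : Matrix (Option ι) (Option ι) ℝ)
    (p : Option ι') :
    transferMat src Y p = (src p).elim 0 fun s => transferVec src (Y s) := by
  ext q
  unfold transferMat transferVec
  cases src p <;> simp

/-- Row sums against the pattern matrix pick out the copied coordinate.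
[cite: StephenTuncel1999, proof of Lemma 4.1 (p. 4)] -/
theorem sum_transferE_mul [Fintype ι] [DecidableEq ι] (src : Option ι' → Option (Option ι))
    (p : Option ι') (f : Option ι → ℝ) :
    ∑ s, transferE src p s * f s = (src p).elim 0 f := by
  rcases h : src p with _ | s₀
  · simp [transferE, h]
  · simp [transferE, h, ite_mul, Finset.sum_ite_eq]

/-- `Ỹ = E Y Eᵀ`. [cite: StephenTuncel1999, proof of Lemma 4.1 (p. 4)] -/
theorem transferMat_eq_mul [Fintype ι] [DecidableEq ι] (src : Option ι' → Option (Option ι))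
    (Y : Matrix (Option ι) (Option ι) ℝ) :
    transferMat src Y = transferE src * Y * (transferE src)ᵀ := by
  ext p q
  have h : (transferE src * Y * (transferE src)ᵀ) p q =
      ∑ s, transferE src p s * ∑ t, transferE src q t * Y s t := by
    simp only [Matrix.mul_apply, Matrix.transpose_apply, Finset.sum_mul, Finset.mul_sum]
    rw [Finset.sum_comm]
    refine Finset.sum_congr rfl fun s _ => Finset.sum_congr rfl fun t _ => ?_
    ring
  rw [h]
  simp_rw [sum_transferE_mul]
  rfl

/-- `Ỹ` is positive semidefinite when `Y` is. [cite: StephenTuncel1999, proof of Lemma 4.1 (p. 4: "Therefore, Ỹ is positive semidefinite")] -/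
theorem posSemidef_transferMat [Fintype ι] [Fintype ι'] [DecidableEq ι] (src : Option ι' → Option (Option ι))
    {Y : Matrix (Option ι) (Option ι) ℝ} (hY : Y.PosSemidef) : (transferMat src Y).PosSemidef := by
  rw [transferMat_eq_mul]
  have h := hY.mul_mul_conjTranspose_same (transferE src)
  simpa [Matrix.conjTranspose_eq_transpose_of_trivial] using h

/-- `Ỹ` is symmetric when `Y` is. [cite: StephenTuncel1999, proof of Lemma 4.1 (p. 4)] -/
theorem isSymm_transferMat (src : Option ι' → Option (Option ι)) {Y : Matrix (Option ι) (Option ι) ℝ}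
    (hY : Y.IsSymm) : (transferMat src Y).IsSymm := by
  refine Matrix.IsSymm.ext fun p q => ?_
  unfold transferMat
  cases src p <;> cases src q <;> simp [hY.apply]

/-- **Lemma 4.1 (engine).** If the pattern keeps the homogenizing coordinate (`src 0 = 0`),
`T` maps `K` into `K'` and `0 ∈ K'`, then `T` maps `N₊(K)` into `N₊(K')`: for `x = Y e₀`,
`Y ∈ M₊(K)`, the matrix `Ỹ = E Y Eᵀ` is in `M₊(K')` with `Ỹ e₀ = T x`.
[cite: StephenTuncel1999, Lemma 4.1 and its proof (pp. 3–4)] -/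
theorem transfer_Nplus [Fintype ι] [Fintype ι'] [DecidableEq ι] {src : Option ι' → Option (Option ι)}
    (h0 : src none = some none) {K : Set (Option ι → ℝ)} {K' : Set (Option ι' → ℝ)}
    (hK : ∀ x ∈ K, transferVec src x ∈ K') (hK'0 : (0 : Option ι' → ℝ) ∈ K')
    {x : Option ι → ℝ} (hx : x ∈ Nplus K) : transferVec src x ∈ Nplus K' := by
  obtain ⟨Y, hY, hYp, rfl⟩ := hx
  refine ⟨transferMat src Y, ⟨isSymm_transferMat src hY.symm, ?_, ?_, ?_⟩,
    posSemidef_transferMat src hYp, ?_⟩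
  · -- diagonal
    intro q
    unfold transferMat
    rw [h0]
    cases hq : src (some q) with
    | none => simp
    | some t =>
      cases t with
      | none => simp
      | some s => simpa using hY.diag_eq s
  · -- rows
    intro p
    rw [transferMat_row]
    cases src p with
    | none => simpa using hK'0
    | some s => simpa using hK _ (hY.row_mem s)
  · -- differences
    intro q
    rw [transferMat_row, transferMat_row, h0]
    cases hq : src (some q) with
    | none => simpa using hK _ (hY.row_mem none)
    | some t =>
      cases t with
      | none => simpa using hK'0
      | some s =>
        simpa [transferVec_sub] using hK _ (hY.sub_mem s)
  · rw [transferMat_row, h0]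
    rfl

/-- **Lemma 4.1 (iterated engine).** Under the same hypotheses with `K'` a pointed cone, `T`
maps `Nʳ₊(K)` into `Nʳ₊(K')` for every `r` ("We prove the statement by induction on `r`").
[cite: StephenTuncel1999, Lemma 4.1 (pp. 3–4)] -/
theorem transfer_iterate_Nplus [Fintype ι] [Fintype ι'] [DecidableEq ι] {src : Option ι' → Option (Option ι)}
    (h0 : src none = some none) {K : Set (Option ι → ℝ)} (C' : PointedCone ℝ (Option ι' → ℝ))
    (hK : ∀ x ∈ K, transferVec src x ∈ (C' : Set (Option ι' → ℝ))) (r : ℕ) :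
    ∀ x ∈ Nplus^[r] K, transferVec src x ∈ Nplus^[r] (C' : Set (Option ι' → ℝ)) := by
  induction r with
  | zero => exact hK
  | succ r ih =>
    intro x hx
    rw [Function.iterate_succ_apply'] at hx ⊢
    have h0' : (0 : Option ι' → ℝ) ∈ Nplus^[r] (C' : Set (Option ι' → ℝ)) := by
      rw [← coe_iterate_NplusCone]
      exact (NplusCone^[r] C').zero_mem
    exact transfer_Nplus h0 ih h0' hx

end LovaszSchrijver

/-! ## Part II. The patterns `wⁱ : P(2k+1) → P(2k+3)` (Lemma 4.1 for the specific map)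

For a finite vertex type `V` and an edge `i = {a, b}` of the clique `K_V`, the clique on
`W_i := V ∖ {a, b}` (as the subtype `{v // v ∉ i}`) plays the role of the `(2k+1)`-clique that
"fixing any edge `i ∈ E_{2k+3}`, throwing away all the edges incident on some endpoint of `i`,
uniquely identifies" (p. 3). The pattern `srcOf i` copies: coordinate `0 ↦ 0`, `i ↦ 0`
(`wⁱ(ζ)_i = ζ₀`, the homogeneous form of the printed "`1` if `j = 0` or `j = i`" under `ζ₀ = 1`),
edges meeting `i` ↦ zero, edges avoiding `i` ↦ the corresponding edge of `K_{W_i}`. -/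

namespace StephenTuncel1999

open LovaszSchrijver

variable {V : Type*} [Fintype V] [DecidableEq V]

/-- An edge `j` AVOIDS the edge `i`: no common endpoint (`{i, j} ∉ Inc` and `j ≠ i`).
[cite: StephenTuncel1999, §4 (p. 3: "Inc(2k+1) … the edges i, j are incident on the same node")] -/
def Avoids (i j : (⊤ : SimpleGraph V).edgeSet) : Prop :=
  ∀ v : V, v ∈ (j : Sym2 V) → v ∉ (i : Sym2 V)

omit [Fintype V] [DecidableEq V] in
/-- `attachWith` preserves off-diagonality. [folklore] -/
private theorem not_isDiag_attachWith {P : V → Prop} (z : Sym2 V) (h : ∀ a ∈ z, P a)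
    (hz : ¬z.IsDiag) : ¬(z.attachWith h).IsDiag := by
  induction z using Sym2.ind with
  | h x y =>
    intro hd
    apply hz
    change (s(⟨x, _⟩, ⟨y, _⟩) : Sym2 {a // P a}).IsDiag at hd
    rw [Sym2.mk_isDiag_iff] at hd ⊢
    exact congrArg Subtype.val hd

omit [Fintype V] [DecidableEq V] in
/-- `attachWith` undoes `map Subtype.val`. [folklore] -/
private theorem attachWith_map_val {P : V → Prop} (e : Sym2 {a // P a})
    (h : ∀ a ∈ e.map Subtype.val, P a) : (e.map Subtype.val).attachWith h = e := by
  induction e using Sym2.ind with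
  | h x y => rfl

omit [Fintype V] [DecidableEq V] in
/-- `map Subtype.val` preserves off-diagonality. [folklore] -/
private theorem not_isDiag_map_val {P : V → Prop} (e : Sym2 {a // P a}) (he : ¬e.IsDiag) :
    ¬(e.map Subtype.val).IsDiag := by
  induction e using Sym2.ind with
  | h x y =>
    intro hd
    apply he
    rw [Sym2.map_mk, Sym2.mk_isDiag_iff] at hd
    rw [Sym2.mk_isDiag_iff]
    exact Subtype.ext hd

/-- The edge of `K_{W_i}` under an edge `j` of `K_V` avoiding `i`.
[cite: StephenTuncel1999, §4 (p. 3), the identification behind `wⁱ`] -/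
def pullEdge (i j : (⊤ : SimpleGraph V).edgeSet) (h : Avoids i j) :
    (⊤ : SimpleGraph {v : V // v ∉ (i : Sym2 V)}).edgeSet :=
  ⟨(j : Sym2 V).attachWith h, by
    simp only [SimpleGraph.edgeSet_top]
    exact not_isDiag_attachWith _ h (SimpleGraph.not_isDiag_of_mem_edgeSet _ j.2)⟩

/-- The edge of `K_V` under an edge of `K_{W_i}`. [cite: StephenTuncel1999, §4 (p. 3)] -/
def pushEdge (i : (⊤ : SimpleGraph V).edgeSet)
    (e : (⊤ : SimpleGraph {v : V // v ∉ (i : Sym2 V)}).edgeSet) : (⊤ : SimpleGraph V).edgeSet :=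
  ⟨(e : Sym2 {v : V // v ∉ (i : Sym2 V)}).map Subtype.val, by
    simp only [SimpleGraph.edgeSet_top]
    exact not_isDiag_map_val _ (SimpleGraph.not_isDiag_of_mem_edgeSet _ e.2)⟩

omit [Fintype V] [DecidableEq V] in
/-- A pushed edge avoids `i`. [cite: StephenTuncel1999, §4 (p. 3)] -/
theorem avoids_pushEdge (i : (⊤ : SimpleGraph V).edgeSet)
    (e : (⊤ : SimpleGraph {v : V // v ∉ (i : Sym2 V)}).edgeSet) : Avoids i (pushEdge i e) := by
  intro v hv
  obtain ⟨w, _, rfl⟩ := Sym2.mem_map.mp hv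
  exact w.2

omit [Fintype V] [DecidableEq V] in
/-- `pull ∘ push = id`. [cite: StephenTuncel1999, §4 (p. 3)] -/
theorem pullEdge_pushEdge (i : (⊤ : SimpleGraph V).edgeSet)
    (e : (⊤ : SimpleGraph {v : V // v ∉ (i : Sym2 V)}).edgeSet) (h : Avoids i (pushEdge i e)) :
    pullEdge i (pushEdge i e) h = e := by
  apply Subtype.ext
  exact attachWith_map_val _ h

omit [Fintype V] [DecidableEq V] in
/-- `push ∘ pull = id`. [cite: StephenTuncel1999, §4 (p. 3)] -/
theorem pushEdge_pullEdge (i j : (⊤ : SimpleGraph V).edgeSet) (h : Avoids i j) :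
    pushEdge i (pullEdge i j h) = j := by
  apply Subtype.ext
  exact Sym2.attachWith_map_subtypeVal h

omit [Fintype V] [DecidableEq V] in
/-- An edge does not avoid itself. [cite: StephenTuncel1999, §4 (p. 3)] -/
theorem not_avoids_self (i : (⊤ : SimpleGraph V).edgeSet) : ¬Avoids i i := by
  obtain ⟨v, hv⟩ : ∃ v : V, v ∈ (i : Sym2 V) := ⟨(i : Sym2 V).out.1, Sym2.out_fst_mem _⟩
  exact fun h => h v hv hv

open scoped Classical in
/-- **The pattern of `wⁱ`** (`srcOf i`): `0 ↦ 0`, `i ↦ 0`, edges meeting `i` ↦ zero row, edges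
avoiding `i` ↦ the corresponding edge of `K_{W_i}`. [cite: StephenTuncel1999, §4, definition of `wⁱ` (p. 3)] -/
def srcOf (i : (⊤ : SimpleGraph V).edgeSet) :
    Option (⊤ : SimpleGraph V).edgeSet →
      Option (Option (⊤ : SimpleGraph {v : V // v ∉ (i : Sym2 V)}).edgeSet)
  | none => some none
  | some j => if j = i then some none else
      if h : Avoids i j then some (some (pullEdge i j h)) else none

omit [Fintype V] in
/-- `srcOf i` keeps the homogenizing coordinate. [cite: StephenTuncel1999, §4 (p. 3)] -/
@[simp] theorem srcOf_none (i : (⊤ : SimpleGraph V).edgeSet) : srcOf i none = some none := rfl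

omit [Fintype V] in
/-- `wⁱ(ζ)_i = ζ₀`. [cite: StephenTuncel1999, §4 (p. 3)] -/
@[simp] theorem srcOf_self (i : (⊤ : SimpleGraph V).edgeSet) : srcOf i (some i) = some none := by
  simp [srcOf]

omit [Fintype V] in
/-- Edges meeting `i` are sent to the zero row. [cite: StephenTuncel1999, §4 (p. 3)] -/
theorem srcOf_of_not_avoids {i j : (⊤ : SimpleGraph V).edgeSet} (hji : j ≠ i) (h : ¬Avoids i j) :
    srcOf i (some j) = none := by
  simp [srcOf, hji, h]

omit [Fintype V] in
/-- Edges avoiding `i` copy the corresponding edge of `K_{W_i}`. [cite: StephenTuncel1999, §4 (p. 3)] -/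
theorem srcOf_of_avoids {i j : (⊤ : SimpleGraph V).edgeSet} (h : Avoids i j) :
    srcOf i (some j) = some (some (pullEdge i j h)) := by
  have hji : j ≠ i := fun hji => not_avoids_self i (hji ▸ h)
  simp [srcOf, hji, h]

omit [Fintype V] in
/-- The pattern on a pushed edge. [cite: StephenTuncel1999, §4 (p. 3)] -/
theorem srcOf_pushEdge (i : (⊤ : SimpleGraph V).edgeSet)
    (e : (⊤ : SimpleGraph {v : V // v ∉ (i : Sym2 V)}).edgeSet) :
    srcOf i (some (pushEdge i e)) = some (some e) := by
  rw [srcOf_of_avoids (avoids_pushEdge i e), pullEdge_pushEdge]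

/-- **Lemma 4.1, base of the induction: `wⁱ` maps `P(2k+1)` into `P(2k+3)`** ("Setting
`xᵢ = 1` … forces `xⱼ = 0` for all `j` such that `{i, j} ∈ Inc(2k+3)`. The remaining variables
have precisely the same constraints on them as those defining `P(2k+1)`", p. 4).
[cite: StephenTuncel1999, proof of Lemma 4.1, case `r = 0` (p. 4)] -/
theorem transferVec_srcOf_mem (i : (⊤ : SimpleGraph V).edgeSet)
    {x : Option (⊤ : SimpleGraph {v : V // v ∉ (i : Sym2 V)}).edgeSet → ℝ}
    (hx : x ∈ fracMatchingCone (⊤ : SimpleGraph {v : V // v ∉ (i : Sym2 V)})) :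
    transferVec (srcOf i) x ∈ fracMatchingCone (⊤ : SimpleGraph V) := by
  classical
  refine ⟨fun p => ?_, fun v => ?_⟩
  · unfold transferVec
    cases srcOf i p with
    | none => simp
    | some s => simpa using hx.1 s
  · rw [transferVec_apply_of_eq_some (srcOf_none i)]
    by_cases hv : v ∈ (i : Sym2 V)
    · -- only the edge `i` itself contributes, with value `x₀`
      rw [Finset.sum_eq_single_of_mem i (mem_filter.mpr ⟨mem_univ _, hv⟩)]
      · rw [transferVec_apply_of_eq_some (srcOf_self i)]
      · intro j hj hji
        have hvj : v ∈ (j : Sym2 V) := (mem_filter.mp hj).2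
        have hna : ¬Avoids i j := fun h => h v hvj hv
        rw [transferVec_apply_of_eq_none (srcOf_of_not_avoids hji hna)]
    · -- the edges at `v` avoiding `i` are the edges of `K_{W_i}` at `⟨v, hv⟩`; the others vanish
      set w : {u : V // u ∉ (i : Sym2 V)} := ⟨v, hv⟩ with hw
      have hsplit : ∑ j ∈ univ.filter (fun j : (⊤ : SimpleGraph V).edgeSet => v ∈ (j : Sym2 V)),
            transferVec (srcOf i) x (some j) =
          ∑ j ∈ (univ.filter (fun j : (⊤ : SimpleGraph V).edgeSet => v ∈ (j : Sym2 V))).filter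
            (fun j => Avoids i j), transferVec (srcOf i) x (some j) := by
        symm
        refine Finset.sum_subset (filter_subset _ _) fun j hj hj' => ?_
        have hvj : v ∈ (j : Sym2 V) := (mem_filter.mp hj).2
        have hna : ¬Avoids i j := fun h => hj' (mem_filter.mpr ⟨hj, h⟩)
        have hji : j ≠ i := fun h => hv (h ▸ hvj)
        exact transferVec_apply_of_eq_none (srcOf_of_not_avoids hji hna) x
      rw [hsplit]
      have hreindex : ∑ j ∈ (univ.filter (fun j : (⊤ : SimpleGraph V).edgeSet =>
            v ∈ (j : Sym2 V))).filter (fun j => Avoids i j), transferVec (srcOf i) x (some j) =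
          ∑ e ∈ univ.filter (fun e : (⊤ : SimpleGraph {u : V // u ∉ (i : Sym2 V)}).edgeSet =>
            w ∈ (e : Sym2 {u : V // u ∉ (i : Sym2 V)})), x (some e) := by
        symm
        refine Finset.sum_bij (fun e _ => pushEdge i e) ?_ ?_ ?_ ?_
        · intro e he
          have hwe : w ∈ (e : Sym2 {u : V // u ∉ (i : Sym2 V)}) := (mem_filter.mp he).2
          refine mem_filter.mpr ⟨mem_filter.mpr ⟨mem_univ _, ?_⟩, avoids_pushEdge i e⟩
          exact Sym2.mem_map.mpr ⟨w, hwe, rfl⟩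
        · intro e₁ _ e₂ _ h
          have h' := congrArg Subtype.val h
          exact Subtype.ext (Sym2.map.injective Subtype.val_injective h')
        · intro j hj
          have hA : Avoids i j := (mem_filter.mp hj).2
          have hvj : v ∈ (j : Sym2 V) := (mem_filter.mp (mem_filter.mp hj).1).2
          refine ⟨pullEdge i j hA, ?_, pushEdge_pullEdge i j hA⟩
          refine mem_filter.mpr ⟨mem_univ _, ?_⟩
          change w ∈ (j : Sym2 V).attachWith hA
          rw [Sym2.attachWith, Sym2.mem_pmap_iff]
          exact ⟨v, hvj, rfl⟩
        · intro e _
          rw [transferVec_apply_of_eq_some (srcOf_pushEdge i e)]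
      rw [hreindex]
      exact hx.2 w

/-! ## Part III-a. Incidence algebra of the clique `K_V`

`B` = vertex–edge incidence matrix, `S = Bᵀ B` (`S_{ef} = |e ∩ f| ∈ {0,1,2}`), `J` = all-ones.
With `N = |V|` and `m = |E| = N(N-1)/2`:  `B Bᵀ = (N-2) I + J_V`, `Bᵀ J_V B = 4 J`,
`S² = (N-2) S + 4 J`, `J S = S J = 2(N-1) J`, `J² = m J`. These identities replace the
eigenvalue computation of the proof of Lemma 4.2 (p. 5–6: "The eigenvalues of `Ŷ` are
`6k²+7k`, `2k+1`, and `0` …"; the eigenspaces there are described through "signed incidence vectors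
of even cycles" and "complete bipartite" vectors, i.e. through `ker B` and `im Bᵀ`). -/

/-- The vertex–edge incidence matrix `B` of `K_V`. [cite: StephenTuncel1999, proof of Lemma 4.2 (pp. 5–6, incidence vectors)] -/
def incMat (V : Type*) [Fintype V] [DecidableEq V] : Matrix V (⊤ : SimpleGraph V).edgeSet ℝ :=
  fun v e => if v ∈ (e : Sym2 V) then 1 else 0

/-- `S = Bᵀ B`, `S_{ef} = |e ∩ f|`. [cite: StephenTuncel1999, proof of Lemma 4.2 (pp. 5–6)] -/
def interMat (V : Type*) [Fintype V] [DecidableEq V] :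
    Matrix (⊤ : SimpleGraph V).edgeSet (⊤ : SimpleGraph V).edgeSet ℝ :=
  (incMat V)ᵀ * incMat V

/-- The all-ones matrix on edges. [cite: StephenTuncel1999, proof of Lemma 4.2 (p. 5, the vector `e`)] -/
def onesE (V : Type*) [Fintype V] [DecidableEq V] :
    Matrix (⊤ : SimpleGraph V).edgeSet (⊤ : SimpleGraph V).edgeSet ℝ :=
  Matrix.of fun _ _ => 1

/-- The all-ones matrix on vertices. [cite: StephenTuncel1999, proof of Lemma 4.2 (p. 5)] -/
def onesV (V : Type*) [Fintype V] [DecidableEq V] : Matrix V V ℝ :=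
  Matrix.of fun _ _ => 1

/-- An edge of `K_V` has exactly two endpoints. [folklore] -/
private theorem card_filter_mem_edge' (e : (⊤ : SimpleGraph V).edgeSet) :
    (univ.filter (fun v : V => v ∈ (e : Sym2 V))).card = 2 := by
  obtain ⟨e, he⟩ := e
  induction e using Sym2.ind with
  | h a b =>
    have hab : a ≠ b := (⊤ : SimpleGraph V).ne_of_adj (by simpa using he)
    have : univ.filter (fun v : V => v ∈ s(a, b)) = {a, b} := by
      ext v
      simp
    rw [this, card_pair hab]

/-- `Σ_v B_{ve} = 2`. [folklore] -/
private theorem sum_incMat_col (e : (⊤ : SimpleGraph V).edgeSet) : ∑ v : V, incMat V v e = 2 := by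
  simp only [incMat]
  rw [Finset.sum_boole, card_filter_mem_edge' e]
  norm_num

/-- The number of edges of `K_V` at a vertex is `|V| - 1`. [folklore] -/
private theorem card_edges_at (v : V) :
    (univ.filter (fun e : (⊤ : SimpleGraph V).edgeSet => v ∈ (e : Sym2 V))).card =
      Fintype.card V - 1 := by
  have h1 : (univ.filter (fun e : (⊤ : SimpleGraph V).edgeSet => v ∈ (e : Sym2 V))).card =
      ((⊤ : SimpleGraph V).incidenceFinset v).card := by
    rw [SimpleGraph.incidenceFinset_eq_filter, ← Finset.card_map (Function.Embedding.subtype _)]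
    congr 1
    ext e
    simp only [Finset.mem_map, Finset.mem_filter, Finset.mem_univ, true_and,
      Function.Embedding.coe_subtype, SimpleGraph.mem_edgeFinset]
    constructor
    · rintro ⟨e', hv, rfl⟩
      exact ⟨e'.2, hv⟩
    · rintro ⟨he, hv⟩
      exact ⟨⟨e, he⟩, hv, rfl⟩
  rw [h1, SimpleGraph.card_incidenceFinset_eq_degree]
  exact SimpleGraph.complete_graph_degree v

/-- `Σ_e B_{ve} = |V| - 1`. [folklore] -/
private theorem sum_incMat_row (v : V) :
    ∑ e : (⊤ : SimpleGraph V).edgeSet, incMat V v e = (Fintype.card V - 1 : ℕ) := by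
  simp only [incMat]
  rw [Finset.sum_boole, card_edges_at v]

/-- Exactly one edge of `K_V` contains two distinct vertices. [folklore] -/
private theorem card_edges_at_pair {v w : V} (hvw : v ≠ w) :
    (univ.filter (fun e : (⊤ : SimpleGraph V).edgeSet =>
      v ∈ (e : Sym2 V) ∧ w ∈ (e : Sym2 V))).card = 1 := by
  have hvw' : s(v, w) ∈ (⊤ : SimpleGraph V).edgeSet := by simpa using hvw
  rw [Finset.card_eq_one]
  refine ⟨⟨s(v, w), hvw'⟩, ?_⟩
  ext e
  simp only [Finset.mem_filter, Finset.mem_univ, true_and, Finset.mem_singleton]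
  rw [Sym2.mem_and_mem_iff hvw]
  constructor
  · intro h; exact Subtype.ext h
  · intro h; exact congrArg Subtype.val h

/-- **`B Bᵀ = (N-2) I + J_V`.** [cite: StephenTuncel1999, proof of Lemma 4.2 (pp. 5–6)] -/
theorem incMat_mul_transpose :
    incMat V * (incMat V)ᵀ = ((Fintype.card V : ℝ) - 2) • (1 : Matrix V V ℝ) + onesV V := by
  ext v w
  simp only [Matrix.mul_apply, Matrix.transpose_apply, Matrix.add_apply, Matrix.smul_apply,
    onesV, Matrix.of_apply, smul_eq_mul]
  have hprod : ∀ e : (⊤ : SimpleGraph V).edgeSet, incMat V v e * incMat V w e =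
      if v ∈ (e : Sym2 V) ∧ w ∈ (e : Sym2 V) then 1 else 0 := by
    intro e
    simp only [incMat]
    split_ifs <;> simp_all
  simp_rw [hprod]
  rw [Finset.sum_boole]
  by_cases hvw : v = w
  · subst hvw
    have : (univ.filter (fun e : (⊤ : SimpleGraph V).edgeSet =>
        v ∈ (e : Sym2 V) ∧ v ∈ (e : Sym2 V))) =
        univ.filter (fun e : (⊤ : SimpleGraph V).edgeSet => v ∈ (e : Sym2 V)) := by
      ext e; simp
    rw [this, card_edges_at v, Matrix.one_apply_eq]
    have h1 : 1 ≤ Fintype.card V := Fintype.card_pos_iff.mpr ⟨v⟩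
    push_cast [Nat.cast_sub h1]
    ring
  · rw [card_edges_at_pair hvw, Matrix.one_apply_ne hvw]
    simp

/-- **`Bᵀ J_V B = 4 J`.** [cite: StephenTuncel1999, proof of Lemma 4.2 (pp. 5–6)] -/
theorem transpose_mul_onesV_mul :
    (incMat V)ᵀ * onesV V * incMat V = (4 : ℝ) • onesE V := by
  ext e f
  simp only [Matrix.mul_apply, Matrix.transpose_apply, onesV, onesE, Matrix.of_apply,
    Matrix.smul_apply, smul_eq_mul, mul_one]
  have : ∀ w : V, (∑ v : V, incMat V v e) * incMat V w f = 2 * incMat V w f := by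
    intro w; rw [sum_incMat_col]
  simp_rw [this]
  rw [← Finset.mul_sum, sum_incMat_col]
  norm_num

/-- **`S² = (N-2) S + 4 J`.** [cite: StephenTuncel1999, proof of Lemma 4.2 (pp. 5–6)] -/
theorem interMat_mul_self :
    interMat V * interMat V = ((Fintype.card V : ℝ) - 2) • interMat V + (4 : ℝ) • onesE V := by
  unfold interMat
  rw [Matrix.mul_assoc, ← Matrix.mul_assoc (incMat V) ((incMat V)ᵀ) (incMat V),
    incMat_mul_transpose, Matrix.add_mul, Matrix.mul_add, Matrix.smul_mul, Matrix.one_mul,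
    Matrix.mul_smul, ← transpose_mul_onesV_mul, Matrix.mul_assoc]

/-- **`J S = 2(N-1) J`.** [cite: StephenTuncel1999, proof of Lemma 4.2 (pp. 5–6)] -/
theorem onesE_mul_interMat :
    onesE V * interMat V = (2 * ((Fintype.card V : ℝ) - 1)) • onesE V := by
  ext e f
  simp only [interMat, Matrix.mul_apply, Matrix.transpose_apply, onesE, Matrix.of_apply,
    Matrix.smul_apply, smul_eq_mul, one_mul, mul_one]
  rw [Finset.sum_comm]
  have : ∀ v : V, ∑ l : (⊤ : SimpleGraph V).edgeSet, incMat V v l * incMat V v f =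
      (Fintype.card V - 1 : ℕ) * incMat V v f := by
    intro v; rw [← Finset.sum_mul, sum_incMat_row]
  simp_rw [this]
  rw [← Finset.mul_sum, sum_incMat_col]
  have h1 : 1 ≤ Fintype.card V :=
    Fintype.card_pos_iff.mpr ⟨(f : Sym2 V).out.1⟩
  push_cast [Nat.cast_sub h1]
  ring

/-- `S` is symmetric. [cite: StephenTuncel1999, proof of Lemma 4.2 (pp. 5–6)] -/
theorem interMat_isSymm : (interMat V).IsSymm := by
  unfold interMat Matrix.IsSymm
  rw [Matrix.transpose_mul, Matrix.transpose_transpose]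

/-- **`S J = 2(N-1) J`.** [cite: StephenTuncel1999, proof of Lemma 4.2 (pp. 5–6)] -/
theorem interMat_mul_onesE :
    interMat V * onesE V = (2 * ((Fintype.card V : ℝ) - 1)) • onesE V := by
  have h := congrArg Matrix.transpose (onesE_mul_interMat (V := V))
  rw [Matrix.transpose_mul, interMat_isSymm.eq, Matrix.transpose_smul] at h
  have hJ : (onesE V)ᵀ = onesE V := by ext e f; rfl
  rwa [hJ] at h

/-- **`J² = m J`**, `m = |E|`. [cite: StephenTuncel1999, proof of Lemma 4.2 (pp. 5–6)] -/
theorem onesE_mul_onesE :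
    onesE V * onesE V = (Fintype.card (⊤ : SimpleGraph V).edgeSet : ℝ) • onesE V := by
  ext e f
  simp [onesE, Matrix.mul_apply]

/-- Entries of `S`: `S_{ef} = |e ∩ f|`. [cite: StephenTuncel1999, proof of Lemma 4.2 (pp. 5–6)] -/
theorem interMat_apply (e f : (⊤ : SimpleGraph V).edgeSet) :
    interMat V e f = ((univ.filter (fun v : V => v ∈ (e : Sym2 V) ∧ v ∈ (f : Sym2 V))).card : ℝ) := by
  simp only [interMat, Matrix.mul_apply, Matrix.transpose_apply]
  have : ∀ v : V, incMat V v e * incMat V v f =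
      if v ∈ (e : Sym2 V) ∧ v ∈ (f : Sym2 V) then 1 else 0 := by
    intro v; simp only [incMat]; split_ifs <;> simp_all
  simp_rw [this]
  rw [Finset.sum_boole]

/-- `S_{ee} = 2`. [cite: StephenTuncel1999, proof of Lemma 4.2 (pp. 5–6)] -/
theorem interMat_self (e : (⊤ : SimpleGraph V).edgeSet) : interMat V e e = 2 := by
  rw [interMat_apply]
  have : univ.filter (fun v : V => v ∈ (e : Sym2 V) ∧ v ∈ (e : Sym2 V)) =
      univ.filter (fun v : V => v ∈ (e : Sym2 V)) := by ext v; simp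
  rw [this, card_filter_mem_edge' e]
  norm_num

/-- Distinct edges share at most one vertex: `S_{ef} ∈ {0, 1}` for `e ≠ f`.
[cite: StephenTuncel1999, proof of Lemma 4.2 (pp. 5–6)] -/
theorem interMat_of_ne {e f : (⊤ : SimpleGraph V).edgeSet} (hef : e ≠ f) :
    interMat V e f = 0 ∨ interMat V e f = 1 := by
  rw [interMat_apply]
  have hle : (univ.filter (fun v : V => v ∈ (e : Sym2 V) ∧ v ∈ (f : Sym2 V))).card ≤ 1 := by
    rw [Finset.card_le_one]
    intro v hv w hw
    by_contra hvw
    have hv' := (mem_filter.mp hv).2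
    have hw' := (mem_filter.mp hw).2
    apply hef
    apply Subtype.ext
    exact Sym2.eq_of_ne_mem hvw hv'.1 hw'.1 hv'.2 hw'.2
  interval_cases h : (univ.filter (fun v : V => v ∈ (e : Sym2 V) ∧ v ∈ (f : Sym2 V))).card <;> simp

/-- Avoiding edges: `S_{ef} = 0`. [cite: StephenTuncel1999, §4 (p. 3) and proof of Lemma 4.2] -/
theorem interMat_of_avoids {e f : (⊤ : SimpleGraph V).edgeSet} (h : Avoids e f) :
    interMat V e f = 0 := by
  rw [interMat_apply]
  have : univ.filter (fun v : V => v ∈ (e : Sym2 V) ∧ v ∈ (f : Sym2 V)) = ∅ := by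
    rw [Finset.filter_eq_empty_iff]
    intro v _ hv
    exact h v hv.2 hv.1
  rw [this]
  simp

/-- Meeting, distinct edges: `S_{ef} = 1`. [cite: StephenTuncel1999, §4 (p. 3) and proof of Lemma 4.2] -/
theorem interMat_of_not_avoids {e f : (⊤ : SimpleGraph V).edgeSet} (hef : e ≠ f) (h : ¬Avoids e f) :
    interMat V e f = 1 := by
  rcases interMat_of_ne hef with h0 | h1
  · exfalso
    apply h
    intro v hvf hve
    rw [interMat_apply] at h0
    have hcard : (univ.filter (fun v : V => v ∈ (e : Sym2 V) ∧ v ∈ (f : Sym2 V))).card = 0 := by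
      exact_mod_cast h0
    rw [Finset.card_eq_zero, Finset.filter_eq_empty_iff] at hcard
    exact hcard (mem_univ v) ⟨hve, hvf⟩
  · exact h1

/-- Scalar form of `J S = 2(N-1) J`: `Σ_l S_{lp} = 2(N-1)`. [cite: StephenTuncel1999, proof of Lemma 4.2 (pp. 5–6)] -/
theorem sum_interMat (p : (⊤ : SimpleGraph V).edgeSet) :
    ∑ l : (⊤ : SimpleGraph V).edgeSet, interMat V l p = 2 * ((Fintype.card V : ℝ) - 1) := by
  have h := congrFun (congrFun (onesE_mul_interMat (V := V)) p) p
  simpa [Matrix.mul_apply, onesE] using h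

/-- Scalar form of `S² = (N-2) S + 4 J`: `Σ_l S_{lp} S_{lq} = (N-2) S_{pq} + 4`.
[cite: StephenTuncel1999, proof of Lemma 4.2 (pp. 5–6)] -/
theorem sum_interMat_mul_interMat (p q : (⊤ : SimpleGraph V).edgeSet) :
    ∑ l : (⊤ : SimpleGraph V).edgeSet, interMat V l p * interMat V l q =
      ((Fintype.card V : ℝ) - 2) * interMat V p q + 4 := by
  have h := congrFun (congrFun (interMat_mul_self (V := V)) p) q
  simp only [Matrix.mul_apply, Matrix.add_apply, Matrix.smul_apply, onesE, Matrix.of_apply,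
    smul_eq_mul, mul_one] at h
  rw [← h]
  refine Finset.sum_congr rfl fun l _ => ?_
  rw [interMat_isSymm.apply p l]

/-! ## Part III-b. The vectors `wˡ(ζ)`, the matrix `Y`, and its positive semidefiniteness -/

/-- `ζ` for a general vertex type: `(1, e/(|V|-1))` (`= (1, (1/2k) e)` when `|V| = 2k+1`).
[cite: StephenTuncel1999, Lemma 4.2 (p. 5)] -/
def zetaOf (V : Type*) [Fintype V] [DecidableEq V] : Option (⊤ : SimpleGraph V).edgeSet → ℝ
  | none => 1
  | some _ => ((Fintype.card V - 1 : ℕ) : ℝ)⁻¹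

/-- `|E(K_V)| = (2k+3)(k+1)` when `|V| = 2k+3`. [folklore] -/
private theorem card_edgeSet_of_card {k : ℕ} (hV : Fintype.card V = 2 * k + 3) :
    Fintype.card (⊤ : SimpleGraph V).edgeSet = (2 * k + 3) * (k + 1) := by
  rw [← SimpleGraph.edgeFinset_card, SimpleGraph.card_edgeFinset_top_eq_card_choose_two, hV,
    Nat.choose_two_right]
  have : (2 * k + 3) * (2 * k + 3 - 1) = (2 * k + 3) * (k + 1) * 2 := by
    rw [show 2 * k + 3 - 1 = 2 * k + 2 by omega]; ring
  rw [this, Nat.mul_div_cancel _ two_pos]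

/-- `|V ∖ l| = |V| - 2` for an edge `l`. [folklore] -/
private theorem card_compl_edge (l : (⊤ : SimpleGraph V).edgeSet) :
    Fintype.card {v : V // v ∉ (l : Sym2 V)} = Fintype.card V - 2 := by
  rw [Fintype.card_subtype_compl, Fintype.card_subtype, card_filter_mem_edge' l]

/-- `ζ ∈ P(K_V)` for `|V| ≥ 2` (each vertex has `|V|-1` edges of weight `1/(|V|-1)`).
[cite: StephenTuncel1999, Lemma 4.2, case `n = 1` (p. 5: "it is easy to see that `(1, e/2) ∈ P(3)`")] -/
theorem zetaOf_mem (hV : 2 ≤ Fintype.card V) :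
    zetaOf V ∈ fracMatchingCone (⊤ : SimpleGraph V) := by
  have hpos : (0 : ℝ) < ((Fintype.card V - 1 : ℕ) : ℝ) := by
    have : 1 ≤ Fintype.card V - 1 := by omega
    exact_mod_cast this
  refine ⟨fun i => ?_, fun v => ?_⟩
  · cases i with
    | none => show (0 : ℝ) ≤ 1; exact zero_le_one
    | some e => show (0 : ℝ) ≤ ((Fintype.card V - 1 : ℕ) : ℝ)⁻¹; exact inv_nonneg.mpr hpos.le
  · show ∑ e ∈ univ.filter (fun e : (⊤ : SimpleGraph V).edgeSet => v ∈ (e : Sym2 V)),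
        ((Fintype.card V - 1 : ℕ) : ℝ)⁻¹ ≤ 1
    rw [sum_const, card_edges_at v, nsmul_eq_mul, mul_inv_cancel₀ hpos.ne']

/-- **The vector `u_l := wˡ(ζ)` in closed form** through `S`: `u_l(0) = 1`,
`u_l(p) = [l = p] + (1 + [l = p] - S_{lp})/(2k)` (`= 1` at `p = l`, `0` on edges meeting `l`,
`1/(2k)` on edges avoiding `l`). [cite: StephenTuncel1999, §4, `wⁱ(ζ)` and Figure 1 (p. 3)] -/
def uvec (k : ℕ) (l : (⊤ : SimpleGraph V).edgeSet) : Option (⊤ : SimpleGraph V).edgeSet → ℝ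
  | none => 1
  | some p => (if l = p then 1 else 0) + (1 + (if l = p then 1 else 0) - interMat V l p) / (2 * k)

/-- `wˡ(ζ_{2k+1}) = u_l` when `|V| = 2k+3`. [cite: StephenTuncel1999, §4 (p. 3) and Lemma 4.2 (p. 5)] -/
theorem transferVec_zetaOf_eq_uvec {k : ℕ} (hV : Fintype.card V = 2 * k + 3)
    (l : (⊤ : SimpleGraph V).edgeSet) :
    transferVec (srcOf l) (zetaOf {v : V // v ∉ (l : Sym2 V)}) = uvec k l := by
  have hW : Fintype.card {v : V // v ∉ (l : Sym2 V)} - 1 = 2 * k := by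
    rw [card_compl_edge l, hV]; omega
  ext b
  cases b with
  | none => simp [transferVec, uvec, zetaOf]
  | some p =>
    by_cases hpl : p = l
    · subst hpl
      rw [transferVec_apply_of_eq_some (srcOf_self p)]
      simp only [zetaOf, uvec, if_true, interMat_self]
      norm_num
    · have hlp : l ≠ p := fun h => hpl h.symm
      by_cases hA : Avoids l p
      · rw [transferVec_apply_of_eq_some (srcOf_of_avoids hA)]
        simp only [zetaOf, uvec, hW, if_neg hlp, interMat_of_avoids hA]
        push_cast
        ring
      · rw [transferVec_apply_of_eq_none (srcOf_of_not_avoids hpl hA)]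
        simp only [uvec, if_neg hlp, interMat_of_not_avoids hlp hA]
        ring

/-- The scaled edge block `Û = 2k·(u_l(p))_{l,p} = (2k+1) I + J - S` (the `E × E` block of the
matrix `Ŷ = 2k(2k+2) Y` of the source, p. 5). [cite: StephenTuncel1999, proof of Lemma 4.2 (p. 5: "`Ŷ := 2k(2k+2)Y`")] -/
def Uhat (V : Type*) [Fintype V] [DecidableEq V] (k : ℕ) :
    Matrix (⊤ : SimpleGraph V).edgeSet (⊤ : SimpleGraph V).edgeSet ℝ :=
  (2 * k + 1 : ℝ) • (1 : Matrix _ _ ℝ) + onesE V - interMat V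

/-- `u_l(p) = Û_{lp} / (2k)`. [cite: StephenTuncel1999, proof of Lemma 4.2 (p. 5)] -/
theorem uvec_some {k : ℕ} (hk : 1 ≤ k) (l p : (⊤ : SimpleGraph V).edgeSet) :
    uvec k l (some p) = Uhat V k l p / (2 * k) := by
  have hk' : (k : ℝ) ≠ 0 := by positivity
  simp only [uvec, Uhat, Matrix.add_apply, Matrix.sub_apply, Matrix.smul_apply, Matrix.one_apply,
    onesE, Matrix.of_apply, smul_eq_mul]
  by_cases h : l = p
  · simp only [h, if_true]
    field_simp
    ring
  · simp only [h, if_false]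
    field_simp
    ring

/-- `Û` is symmetric. [cite: StephenTuncel1999, proof of Lemma 4.2 (p. 5: "Y … is symmetric")] -/
theorem Uhat_isSymm (k : ℕ) : (Uhat V k).IsSymm := by
  unfold Uhat
  refine Matrix.IsSymm.sub (Matrix.IsSymm.add ((Matrix.isSymm_one).smul _) ?_) interMat_isSymm
  exact Matrix.IsSymm.ext fun _ _ => rfl

/-- **`S Û = 4k J`** (`|V| = 2k+3`). [cite: StephenTuncel1999, proof of Lemma 4.2 (p. 5)] -/
theorem interMat_mul_Uhat {k : ℕ} (hV : Fintype.card V = 2 * k + 3) :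
    interMat V * Uhat V k = (4 * k : ℝ) • onesE V := by
  have hN : (Fintype.card V : ℝ) = 2 * k + 3 := by exact_mod_cast hV
  unfold Uhat
  rw [Matrix.mul_sub, Matrix.mul_add, Matrix.mul_smul, Matrix.mul_one, interMat_mul_onesE,
    interMat_mul_self, hN]
  module

/-- **`J Û = k(2k+3) J`** (`|V| = 2k+3`, `|E| = (2k+3)(k+1)`). [cite: StephenTuncel1999, proof of Lemma 4.2 (p. 5)] -/
theorem onesE_mul_Uhat {k : ℕ} (hV : Fintype.card V = 2 * k + 3) :
    onesE V * Uhat V k = (k * (2 * k + 3) : ℝ) • onesE V := by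
  have hN : (Fintype.card V : ℝ) = 2 * k + 3 := by exact_mod_cast hV
  have hm : (Fintype.card (⊤ : SimpleGraph V).edgeSet : ℝ) = (2 * k + 3) * (k + 1) := by
    exact_mod_cast card_edgeSet_of_card hV
  unfold Uhat
  rw [Matrix.mul_sub, Matrix.mul_add, Matrix.mul_smul, Matrix.mul_one, onesE_mul_onesE,
    onesE_mul_interMat, hN, hm]
  module

/-- `Σ_l u_l(q) = (2k+3)/2` (`|V| = 2k+3`). [cite: StephenTuncel1999, proof of Lemma 4.2 (p. 4: `Σᵢ wⁱ(ζ)`)] -/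
theorem sum_uvec_some {k : ℕ} (hk : 1 ≤ k) (hV : Fintype.card V = 2 * k + 3)
    (q : (⊤ : SimpleGraph V).edgeSet) :
    ∑ l : (⊤ : SimpleGraph V).edgeSet, uvec k l (some q) = (2 * k + 3) / 2 := by
  have hk' : (k : ℝ) ≠ 0 := by positivity
  have h := congrFun (congrFun (onesE_mul_Uhat (V := V) hV) q) q
  simp only [Matrix.mul_apply, onesE, Matrix.of_apply, one_mul, Matrix.smul_apply, smul_eq_mul,
    mul_one] at h
  simp_rw [uvec_some hk]
  rw [← Finset.sum_div, h]
  field_simp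

/-- `Σ_l (S_{lp} - 2[l=p]) u_l(q) = 2 - 2 u_p(q)`, i.e. `(S - 2I) Û / (2k) = (4kJ - 2Û)/(2k)`
(`|V| = 2k+3`). [cite: StephenTuncel1999, proof of Lemma 4.2 (p. 5: the formula for `Y(e₀ - eᵢ)`)] -/
theorem wsum_uvec_some {k : ℕ} (hk : 1 ≤ k) (hV : Fintype.card V = 2 * k + 3)
    (p q : (⊤ : SimpleGraph V).edgeSet) :
    ∑ l : (⊤ : SimpleGraph V).edgeSet,
        (interMat V l p - 2 * (if l = p then 1 else 0)) * uvec k l (some q) =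
      2 - 2 * uvec k p (some q) := by
  have hk' : (k : ℝ) ≠ 0 := by positivity
  have h := congrFun (congrFun (interMat_mul_Uhat (V := V) hV) p) q
  simp only [Matrix.mul_apply, onesE, Matrix.of_apply, Matrix.smul_apply, smul_eq_mul,
    mul_one] at h
  have hsym : ∀ l, interMat V l p = interMat V p l := fun l => (interMat_isSymm (V := V)).apply p l
  simp_rw [uvec_some hk, hsym]
  have e : ∀ l : (⊤ : SimpleGraph V).edgeSet,
      (interMat V p l - 2 * (if l = p then 1 else 0)) * (Uhat V k l q / (2 * k)) =
        (interMat V p l * Uhat V k l q) / (2 * k) - (if l = p then Uhat V k l q / k else 0) := by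
    intro l
    by_cases hl : l = p
    · simp only [hl, if_true]; field_simp
    · simp only [hl, if_false]; field_simp; ring
  simp_rw [e]
  rw [Finset.sum_sub_distrib, ← Finset.sum_div, h, Finset.sum_ite_eq' univ p, if_pos (mem_univ _)]
  field_simp
  ring

/-- **`Y e₀ = (1/m) Σ_l u_l`**: `ζ_{2k+3}` is a nonnegative combination of the `u_l`
(p. 4: "`Ye₀ … = (2/(2k+3)) Σ_{i ∈ E_{2k+3}} Yeᵢ`"). [cite: StephenTuncel1999, proof of Lemma 4.2 (p. 4)] -/
theorem zetaOf_eq_sum_uvec {k : ℕ} (hk : 1 ≤ k) (hV : Fintype.card V = 2 * k + 3) :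
    zetaOf V = ∑ l : (⊤ : SimpleGraph V).edgeSet, (((2 * k + 3) * (k + 1) : ℝ)⁻¹) • uvec k l := by
  have hm := card_edgeSet_of_card hV
  ext b
  rw [Finset.sum_apply]
  simp only [Pi.smul_apply, smul_eq_mul, ← Finset.mul_sum]
  cases b with
  | none =>
    simp only [zetaOf, uvec, Finset.sum_const, Finset.card_univ, hm, nsmul_eq_mul, mul_one]
    push_cast
    field_simp
  | some q =>
    rw [sum_uvec_some hk hV q]
    simp only [zetaOf, hV]
    push_cast
    field_simp

/-- **`Y(e₀ - e_p) = (1/(2(2k+2))) Σ_{l adjacent to p} u_l`**: the differences are nonnegative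
combinations of the `u_l` (p. 5). [cite: StephenTuncel1999, proof of Lemma 4.2 (p. 5)] -/
theorem zetaOf_sub_eq_wsum_uvec {k : ℕ} (hk : 1 ≤ k) (hV : Fintype.card V = 2 * k + 3)
    (p : (⊤ : SimpleGraph V).edgeSet) :
    zetaOf V - ((2 * k + 2 : ℝ)⁻¹) • uvec k p =
      ∑ l : (⊤ : SimpleGraph V).edgeSet,
        (((2 * (2 * k + 2) : ℝ)⁻¹) * (interMat V l p - 2 * (if l = p then 1 else 0))) • uvec k l := by
  have hN : (Fintype.card V : ℝ) = 2 * k + 3 := by exact_mod_cast hV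
  ext b
  rw [Finset.sum_apply]
  simp only [Pi.sub_apply, Pi.smul_apply, smul_eq_mul, mul_assoc, ← Finset.mul_sum]
  cases b with
  | none =>
    have h1 : ∑ l : (⊤ : SimpleGraph V).edgeSet,
        (interMat V l p - 2 * (if l = p then 1 else 0)) * uvec k l none =
          2 * ((Fintype.card V : ℝ) - 1) - 2 := by
      simp only [uvec, mul_one]
      rw [Finset.sum_sub_distrib, sum_interMat p, ← Finset.mul_sum, Finset.sum_ite_eq' univ p,
        if_pos (mem_univ _)]
      ring
    rw [h1, hN]
    simp only [zetaOf, uvec]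
    field_simp
    ring
  | some q =>
    rw [wsum_uvec_some hk hV p q]
    simp only [zetaOf, hV]
    push_cast
    field_simp

/-! ## Part III-c. The matrix `Y ∈ M₊(N^{k-1}₊(P(2k+3)))` with `Y e₀ = ζ_{2k+3}` -/

/-- `R' = (k+1)Û - kJ = (2k+1)(k+1) I + J - (k+1) S`, the (scaled) `E × E` block of
`Ŷ - c cᵀ/(2k(2k+2))`; it satisfies `R'² = (2k+1)(k+1) R'` (it is `(2k+1)(k+1)` times the
projection onto `ker B`, the eigenvalue-`(2k+1)` eigenspace of `Ŷ`, p. 5).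
[cite: StephenTuncel1999, proof of Lemma 4.2 (pp. 5–6, the eigenspace of `2k+1`)] -/
def Rmat (V : Type*) [Fintype V] [DecidableEq V] (k : ℕ) :
    Matrix (⊤ : SimpleGraph V).edgeSet (⊤ : SimpleGraph V).edgeSet ℝ :=
  ((2 * k + 1) * (k + 1) : ℝ) • (1 : Matrix _ _ ℝ) + onesE V - (k + 1 : ℝ) • interMat V

/-- `R'` is symmetric. [cite: StephenTuncel1999, proof of Lemma 4.2 (p. 5)] -/
theorem Rmat_isSymm (k : ℕ) : (Rmat V k).IsSymm := by
  unfold Rmat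
  refine Matrix.IsSymm.sub (Matrix.IsSymm.add ((Matrix.isSymm_one).smul _) ?_)
    (interMat_isSymm.smul _)
  exact Matrix.IsSymm.ext fun _ _ => rfl

/-- **`R'² = (2k+1)(k+1) R'`** (`|V| = 2k+3`). [cite: StephenTuncel1999, proof of Lemma 4.2 (pp. 5–6)] -/
theorem Rmat_mul_self {k : ℕ} (hV : Fintype.card V = 2 * k + 3) :
    Rmat V k * Rmat V k = ((2 * k + 1) * (k + 1) : ℝ) • Rmat V k := by
  have hN : (Fintype.card V : ℝ) = 2 * k + 3 := by exact_mod_cast hV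
  have hm : (Fintype.card (⊤ : SimpleGraph V).edgeSet : ℝ) = (2 * k + 3) * (k + 1) := by
    exact_mod_cast card_edgeSet_of_card hV
  unfold Rmat
  simp only [Matrix.add_mul, Matrix.mul_add, Matrix.sub_mul, Matrix.mul_sub, Matrix.smul_mul,
    Matrix.mul_smul, Matrix.one_mul, Matrix.mul_one, onesE_mul_onesE, onesE_mul_interMat,
    interMat_mul_onesE, interMat_mul_self, hN, hm]
  module

/-- The block matrix `N = 0 ⊕ R'` on `{0} ∪ E`. [cite: StephenTuncel1999, proof of Lemma 4.2 (pp. 5–6)] -/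
def Nmat (V : Type*) [Fintype V] [DecidableEq V] (k : ℕ) :
    Matrix (Option (⊤ : SimpleGraph V).edgeSet) (Option (⊤ : SimpleGraph V).edgeSet) ℝ :=
  fun a b => a.elim 0 fun l => b.elim 0 fun q => Rmat V k l q

/-- `N` is symmetric. [cite: StephenTuncel1999, proof of Lemma 4.2 (p. 5)] -/
theorem Nmat_isSymm (k : ℕ) : (Nmat V k).IsSymm := by
  refine Matrix.IsSymm.ext fun a b => ?_
  cases a <;> cases b <;> simp [Nmat, (Rmat_isSymm (V := V) k).apply]

/-- `N² = (2k+1)(k+1) N` (`|V| = 2k+3`). [cite: StephenTuncel1999, proof of Lemma 4.2 (pp. 5–6)] -/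
theorem Nmat_mul_self {k : ℕ} (hV : Fintype.card V = 2 * k + 3) :
    Nmat V k * Nmat V k = ((2 * k + 1) * (k + 1) : ℝ) • Nmat V k := by
  ext a b
  rw [Matrix.mul_apply, Fintype.sum_option, Matrix.smul_apply]
  cases a with
  | none => simp [Nmat]
  | some l =>
    cases b with
    | none => simp [Nmat]
    | some q =>
      have h := congrFun (congrFun (Rmat_mul_self (V := V) hV) l) q
      rw [Matrix.mul_apply, Matrix.smul_apply] at h
      simpa [Nmat] using h

/-- `N` is positive semidefinite (`N = N Nᵀ / ((2k+1)(k+1))`). [cite: StephenTuncel1999, proof of Lemma 4.2 (p. 6: "each of the three eigenvalues is nonnegative")] -/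
theorem posSemidef_Nmat {k : ℕ} (hV : Fintype.card V = 2 * k + 3) : (Nmat V k).PosSemidef := by
  have hA : (0 : ℝ) < (2 * k + 1) * (k + 1) := by positivity
  have hsymm : (Nmat V k)ᴴ = Nmat V k := by
    rw [Matrix.conjTranspose_eq_transpose_of_trivial]
    exact (Nmat_isSymm (V := V) k).eq
  have h1 : (Nmat V k * Nmat V k).PosSemidef := by
    have h := Matrix.posSemidef_self_mul_conjTranspose (Nmat V k)
    rwa [hsymm] at h
  rw [Nmat_mul_self hV] at h1
  have h2 := h1.smul (a := (((2 * k + 1) * (k + 1) : ℝ))⁻¹) (inv_nonneg.mpr hA.le)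
  rwa [smul_smul, inv_mul_cancel₀ hA.ne', one_smul] at h2

/-- The vector `c = (2k(2k+2), 2k e)` of the rank-one part of `Ŷ` (the eigenvector
`((2k+2)/?, e)`-direction, p. 5). [cite: StephenTuncel1999, proof of Lemma 4.2 (p. 5: "The eigenvector corresponding to the eigenvalue `6k²+7k`")] -/
def cvec (k : ℕ) : Option (⊤ : SimpleGraph V).edgeSet → ℝ
  | none => 2 * k * (2 * k + 2)
  | some _ => 2 * k

/-- **The matrix `Y`** of the inductive step: `Y e₀ = ζ_{2k+3}`, `Y e_l = u_l/(2k+2)`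
(p. 4: "`Yeᵢ := (1/(2k+2)) wⁱ(ζ)` for `i ∈ E_{2k+3}`, `Ye₀ := (1, (1/(2k+2)) e)`").
[cite: StephenTuncel1999, proof of Lemma 4.2, definition of `Y` (p. 4)] -/
def Ymat (V : Type*) [Fintype V] [DecidableEq V] (k : ℕ) :
    Matrix (Option (⊤ : SimpleGraph V).edgeSet) (Option (⊤ : SimpleGraph V).edgeSet) ℝ :=
  fun a b => a.elim (zetaOf V b) fun l => (2 * k + 2 : ℝ)⁻¹ * uvec k l b

/-- **The PSD decomposition** `Y = c cᵀ/(2k(2k+2))² + N/(2k(2k+2)(k+1))` replacing the spectral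
computation of pp. 5–6. [cite: StephenTuncel1999, proof of Lemma 4.2 (pp. 5–6)] -/
theorem Ymat_eq {k : ℕ} (hk : 1 ≤ k) (hV : Fintype.card V = 2 * k + 3) :
    Ymat V k = (((2 * k * (2 * k + 2)) ^ 2 : ℝ))⁻¹ • vecMulVec (cvec k) (cvec k) +
      ((2 * k * (2 * k + 2) * (k + 1) : ℝ))⁻¹ • Nmat V k := by
  have hk' : (k : ℝ) ≠ 0 := by positivity
  have hc : ((Fintype.card V - 1 : ℕ) : ℝ) = 2 * k + 2 := by
    rw [hV]; push_cast; ring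
  ext a b
  cases a with
  | none =>
    cases b with
    | none =>
      simp only [Ymat, Nmat, cvec, zetaOf, Option.elim_none, Matrix.add_apply, Matrix.smul_apply,
        vecMulVec_apply, smul_eq_mul, mul_zero, add_zero]
      field_simp
    | some q =>
      simp only [Ymat, Nmat, cvec, zetaOf, hc, Option.elim_none, Matrix.add_apply, Matrix.smul_apply,
        vecMulVec_apply, smul_eq_mul, mul_zero, add_zero]
      field_simp
  | some l =>
    cases b with
    | none =>
      simp only [Ymat, Nmat, cvec, uvec, Option.elim_none, Option.elim_some, Matrix.add_apply,
        Matrix.smul_apply, vecMulVec_apply, smul_eq_mul, mul_zero, add_zero, mul_one]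
      field_simp
    | some q =>
      simp only [Ymat, Nmat, cvec, uvec_some hk, Uhat, Rmat, Option.elim_some, Matrix.add_apply,
        Matrix.sub_apply, Matrix.smul_apply, vecMulVec_apply, smul_eq_mul, onesE, Matrix.of_apply]
      field_simp
      ring

/-- **`Y` is positive semidefinite.** [cite: StephenTuncel1999, proof of Lemma 4.2 (p. 6: "`Ŷ`, and hence `Y` is positive semidefinite")] -/
theorem posSemidef_Ymat {k : ℕ} (hk : 1 ≤ k) (hV : Fintype.card V = 2 * k + 3) :
    (Ymat V k).PosSemidef := by
  rw [Ymat_eq hk hV]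
  refine Matrix.PosSemidef.add ?_ ?_
  · refine Matrix.PosSemidef.smul ?_ (by positivity)
    simpa using Matrix.posSemidef_vecMulVec_self_star (cvec (V := V) k)
  · exact (posSemidef_Nmat hV).smul (by positivity)

/-- `u_l(l) = 1`. [cite: StephenTuncel1999, §4 (p. 3: "`wⁱ(ζ)_j := 1` if `j = i`")] -/
theorem uvec_self (k : ℕ) (l : (⊤ : SimpleGraph V).edgeSet) : uvec k l (some l) = 1 := by
  simp only [uvec, if_true, interMat_self]
  norm_num

/-- The weights `S_{lp} - 2[l = p]` of the combination for `Y(e₀ - e_p)` are nonnegative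
(they select the edges adjacent to `p`). [cite: StephenTuncel1999, proof of Lemma 4.2 (p. 5: the sum over `l : {i,l} ∈ Inc`)] -/
theorem weight_nonneg (l p : (⊤ : SimpleGraph V).edgeSet) :
    0 ≤ interMat V l p - 2 * (if l = p then 1 else 0) := by
  by_cases h : l = p
  · subst h; simp [interMat_self]
  · rw [if_neg h, interMat_apply]; simp

/-- **`Y ∈ M₊(K')`** for every pointed cone `K'` containing all `u_l`, `|V| = 2k+3`, `k ≥ 1`:
symmetric, `Ye₀ = Diag(Y)`, `Yeᵢ ∈ K'` ("`Yeᵢ` is a positive multiple of `wⁱ(ζ)`", "`Ye₀` is a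
nonnegative linear combination of `Yeᵢ`s"), `Y(e₀ − eᵢ) ∈ K'` ("a nonnegative linear combination
of elements of `N^{k-1}₊`"), and positive semidefinite. [cite: StephenTuncel1999, proof of Lemma 4.2 (pp. 4–6)] -/
theorem isLiftMatrix_Ymat {k : ℕ} (hk : 1 ≤ k) (hV : Fintype.card V = 2 * k + 3)
    (C' : PointedCone ℝ (Option (⊤ : SimpleGraph V).edgeSet → ℝ))
    (hu : ∀ l : (⊤ : SimpleGraph V).edgeSet, uvec k l ∈ (C' : Set (Option (⊤ : SimpleGraph V).edgeSet → ℝ))) :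
    IsLiftMatrix (C' : Set (Option (⊤ : SimpleGraph V).edgeSet → ℝ)) (Ymat V k) := by
  have hc : ((Fintype.card V - 1 : ℕ) : ℝ) = 2 * k + 2 := by
    rw [hV]; push_cast; ring
  refine ⟨?_, ?_, ?_, ?_⟩
  · -- symmetric
    refine Matrix.IsSymm.ext fun a b => ?_
    cases a with
    | none =>
      cases b with
      | none => rfl
      | some q => simp [Ymat, zetaOf, hc, uvec]
    | some l =>
      cases b with
      | none => simp [Ymat, zetaOf, hc, uvec]
      | some q =>
        simp only [Ymat, Option.elim_some, uvec_some hk]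
        rw [(Uhat_isSymm (V := V) k).apply l q]
  · -- diagonal
    intro q
    simp [Ymat, zetaOf, hc, uvec_self]
  · -- rows
    intro a
    cases a with
    | none =>
      have hrow : Ymat V k none = zetaOf V := rfl
      rw [hrow, zetaOf_eq_sum_uvec hk hV]
      exact C'.sum_mem fun l _ => C'.smul_mem (by positivity) (hu l)
    | some l =>
      have hrow : Ymat V k (some l) = (2 * k + 2 : ℝ)⁻¹ • uvec k l := by
        ext b; simp [Ymat]
      rw [hrow]
      exact C'.smul_mem (by positivity) (hu l)
  · -- differences
    intro q
    have hrow0 : Ymat V k none = zetaOf V := rfl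
    have hrow : Ymat V k (some q) = (2 * k + 2 : ℝ)⁻¹ • uvec k q := by
      ext b; simp [Ymat]
    rw [hrow0, hrow, zetaOf_sub_eq_wsum_uvec hk hV q]
    exact C'.sum_mem fun l _ =>
      C'.smul_mem (mul_nonneg (by positivity) (weight_nonneg l q)) (hu l)

/-! ## Part IV. The induction (Lemma 4.2) and the discharge -/

universe u in
/-- **Lemma 4.2 for every clique on `2k+1` vertices** (`k ≥ 1`): `ζ = (1, e/2k) ∈ N^{k-1}₊(P)`.
Induction on `k`: for `|V| = 2k+3`, the vectors `u_l = wˡ(ζ_{W_l})` lie in `N^{k-1}₊(P(K_V))`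
by the induction hypothesis for the cliques `K_{W_l}` and Lemma 4.1, and `Y ∈ M₊(N^{k-1}₊(P))`
with `Y e₀ = ζ`. [cite: StephenTuncel1999, Lemma 4.2 and its proof (pp. 4–6)] -/
theorem zetaOf_mem_iterate_Nplus (k : ℕ) (hk : 1 ≤ k) :
    ∀ (V : Type u) [Fintype V] [DecidableEq V], Fintype.card V = 2 * k + 1 →
      zetaOf V ∈ Nplus^[k - 1] (fracMatchingCone (⊤ : SimpleGraph V)) := by
  induction k, hk using Nat.le_induction with
  | base =>
    intro V _ _ hV
    simpa using zetaOf_mem (V := V) (by omega)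
  | succ k hk ih =>
    intro V _ _ hV
    have hV' : Fintype.card V = 2 * k + 3 := by omega
    -- `N^{k}₊ = N₊ ∘ N^{k-1}₊`
    obtain ⟨j, rfl⟩ : ∃ j, k = j + 1 := ⟨k - 1, by omega⟩
    rw [show j + 1 + 1 - 1 = j + 1 from rfl, Function.iterate_succ_apply']
    -- the cone `K' = N^{k-1}₊(P(K_V))`
    set C' : PointedCone ℝ (Option (⊤ : SimpleGraph V).edgeSet → ℝ) :=
      NplusCone^[j] (fracMatchingPointedCone (⊤ : SimpleGraph V)) with hC'
    have hcoe : (C' : Set (Option (⊤ : SimpleGraph V).edgeSet → ℝ)) =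
        Nplus^[j] (fracMatchingCone (⊤ : SimpleGraph V)) :=
      coe_iterate_NplusCone _ j
    -- each `u_l` lies in `K'` (induction hypothesis on `K_{W_l}` + Lemma 4.1)
    have hu : ∀ l : (⊤ : SimpleGraph V).edgeSet,
        uvec (j + 1) l ∈ (C' : Set (Option (⊤ : SimpleGraph V).edgeSet → ℝ)) := by
      intro l
      have hW : Fintype.card {v : V // v ∉ (l : Sym2 V)} = 2 * (j + 1) + 1 := by
        rw [card_compl_edge l, hV]; omega
      have hζ := ih {v : V // v ∉ (l : Sym2 V)} hW
      rw [show j + 1 - 1 = j from rfl] at hζ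
      have ht := transfer_iterate_Nplus (srcOf_none l)
        (fracMatchingPointedCone (⊤ : SimpleGraph V))
        (fun x hx => transferVec_srcOf_mem l hx) j _ hζ
      rw [transferVec_zetaOf_eq_uvec hV' l] at ht
      rw [hcoe]
      exact ht
    -- the lift matrix `Y`
    have hY := isLiftMatrix_Ymat (by omega) hV' C' hu
    rw [← hcoe]
    exact ⟨Ymat V (j + 1), hY, posSemidef_Ymat (by omega) hV', rfl⟩

/-- **Lemma 4.2 (Stephen–Tunçel 1999), PROVED**: `(1, (1/2n) e) ∈ N^{n-1}₊(P(2n+1))` for all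
`n ≥ 1` — the discharge of the named fact `StephenTuncel1999_lemma42`. With it the lower bound
`Nʳ₊(P(2n+1)) ≠ P_I(2n+1)` for `r < n` (`iterate_Nplus_ne_of_lt`) is unconditional.
[cite: StephenTuncel1999, Lemma 4.2 (p. 5)] -/
theorem StephenTuncel1999_lemma42_holds : StephenTuncel1999_lemma42 := by
  intro n hn
  have h := zetaOf_mem_iterate_Nplus n hn (Fin (2 * n + 1)) (by simp)
  have hz : zeta n = zetaOf (Fin (2 * n + 1)) := by
    funext b
    cases b with
    | none => rfl
    | some e =>
      simp only [zeta, zetaOf, Fintype.card_fin]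
      push_cast
      ring_nf
  rw [hz]
  exact h

/-- **Unconditional lower bound**: `Nʳ₊(P(2n+1)) ≠ P_I(2n+1)` for all `r < n` ("at least `n`
iterations of the procedure are needed", p. 1). [cite: StephenTuncel1999, Thm. 5.1 (p. 6) and §1 (p. 1)] -/
theorem iterate_Nplus_ne_matchingCone (n : ℕ) (hn : 1 ≤ n) (r : ℕ) (hr : r < n) :
    Nplus^[r] (fracMatchingCone (⊤ : SimpleGraph (Fin (2 * n + 1)))) ≠
      matchingCone (⊤ : SimpleGraph (Fin (2 * n + 1))) :=
  iterate_Nplus_ne_of_lt StephenTuncel1999_lemma42_holds n hn r hr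

/-- **Theorem 5.1 modulo the upper bound only.** [cite: StephenTuncel1999, Thm. 5.1 (p. 6)] -/
theorem StephenTuncel1999_thm51_of_rank_le_half (hhalf : StephenTuncel1999_rank_le_half)
    (n : ℕ) (hn : 1 ≤ n) :
    Nplus^[n - 1] (fracMatchingCone (⊤ : SimpleGraph (Fin (2 * n + 1)))) ≠
        matchingCone (⊤ : SimpleGraph (Fin (2 * n + 1))) ∧
      Nplus^[n] (fracMatchingCone (⊤ : SimpleGraph (Fin (2 * n + 1)))) =
        matchingCone (⊤ : SimpleGraph (Fin (2 * n + 1))) :=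
  StephenTuncel1999_thm51 StephenTuncel1999_lemma42_holds hhalf n hn

end StephenTuncel1999

end Literature.Combinatorics.Optimization
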